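import Summits.BirchSwinnertonDyer.BirchSwinnertonDyer.Theorems.ManinLocalTwoThreeBracketSturmOneThirtyFiveA
import Summits.BirchSwinnertonDyer.BirchSwinnertonDyer.Theorems.ManinLocalTwoThreeSameLevelTwistRootFormTransport
import Summits.BirchSwinnertonDyer.Rank1Residual.ManinAdditive.TwistOrbitManinTransportProof
import Literature.NumberTheory.EllipticCurves.CuspFormTwist
import Literature.NumberTheory.EllipticCurves.RootNumberTwistProofs
import Literature.NumberTheory.EllipticCurves.QuadraticTwist
import Summits.BirchSwinnertonDyer.BirchSwinnertonDyer.Theorems.ManinLocalTwoThreeExistsMinimalOptimalDatumUnconditional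
import Summits.BirchSwinnertonDyer.Rank1Residual.Additive.IntModelConductorCertificate
import HarnessLib

/-!
# Level 135 = 3³·5 (C3 domain, `27 ∥ 135` — the TWIST-MINIMAL cell at 3; genus 13; TWO classes `135a`, `135b = 135a ⊗ χ₋₃`) COMPLETE:
# `|c| = 1` — hence `3 ∤ c` — for EVERY lattice-optimal `X₀(135)`-datum of EVERY globally minimal elliptic curve over `ℚ`, UNCONDITIONALLY

Cell `bsd-f2-manin`, route `ManinLocalTwoThree`, crux C3 `ManinPrimeToThreeAtNine` (stmt-BirchSwinnertonDyer-22968: `3² ∣ 135`); prover seat p3 gen 27;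
`--supports` (helper).  ASSEMBLY of three roads of the cell at the second level of the charter's `27 ∣ N` cell (after `108`, `189`):
* an g54's FACT-FREE two-row kernel pinning `PinningOneThirtyFive.pinning`: for every `X₀(135)`-datum `D`, `d′ • D.f = Σ_j y_j • C_j` on the
  `24`-quotient `η`-basis `C` of `M₂(Γ₀(135))` for one of the two certificates `rowA` (`135a`, `d′ = 30`) / `rowB` (`135b`, `d′ = 120`);
* this seat's depth-`218` tables (`…EtaTablesOneThirtyFiveDeepA–L`) and the weight-2 Bracket–Sturm certificate of `135a` in its FORM-LEVEL shape
  `LevelOneThirtyFive.periodLatticeLe_oneThirtyFiveA_of_coeff` (`Λ(f) ⊆ Λ_Néron(135a1)` for every `f ∈ S₂(Γ₀(135))` with `aₙ(f) = aₙ(135a)`, `n < 218`);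
* **NEW HERE — the SAME-LEVEL ALIGNED `χ₋₃`-TRANSPORT for `135b`**, the class with NO weight-2 (or weight-4) presentation `x∘φ = A/B`
  (`deg φ = 36`): `135b1 = [0,0,1,−27,−115]` is the twist of `135a1 = [0,0,1,−3,4]` by `−3` with the ALIGNED minimal model
  (`(1,0,0,½) • (135a1)^{(−3)} = 135b1`, `Δ(135b1) = (−3)⁶·Δ(135a1) = −3¹¹·5²`), both additive at `3`.  For a datum `D` on the row `135b` the
  ROOT FORM is built INSIDE the datum: `f₀ := (D.f)^{χ₋₃} = charTwist 135 _ _ (·/3) D.f ∈ S₂(Γ₀(135))` (`9 ∣ 135`; Shimura 3.64); its first `218`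
  coefficients are `(n/3)·aₙ(135b) = aₙ(135a)` (one `decide` on the deep tables), so the class-`a` certificate squeezes `Λ(f₀) ⊆ Λ_Néron(135a1)`;
  `D.f = (f₀)^{χ₋₃}` in `S₂(Γ₀(135))` (Sturm at weight 2: `aₙ(135b)·(1 − (n/3)²) = 0` for `n < 218`, i.e. `a₃ₖ(135b) = 0` — additivity at `3` read
  off the table, no reduction theory); the tree's `Γ₀`-twisting theorem (`gaussSum_mul_mem_periodLattice_of_mem_charTwist`, Stevens (5.4), via p3's
  `OddTwistRootForm.periodLattice_le_of_rootForm_charTwist`, packaged with the next step as this seat's ENGINE `…SameLevelTwistRootFormTransport`) and the aligned Néron-lattice identity `Λ(135b1) = g(χ₃)⁻¹·Λ(135a1)`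
  (`neronLattice_mem_iff_of_twist_pStar`, `r = 1`, Pal 2012 Lemma 3.1 — NO semistability needed, unlike Stevens (5.2)) give `Λ(D.f) ⊆ Λ_Néron(135b1)`,
  and p3's Néron squeeze gives `|c(D)| = 1`.  This is the first C3 class closed by transport between two ADDITIVE fibres at `3` at the SAME level.
RESULTS: `abs_maninConstant_eq_one_oneThirtyFive` (`|c| = 1` on all of `X₀(135)`), `not_three_dvd_…`, `not_prime_dvd_…`,
`maninPrimeToThreeAtNine_oneThirtyFive : 3² ∣ 135 ∧ ∀ W D, hopt → |c| = 1 ∧ 3 ∤ c`, and the identification `f_eq_charTwist_charTwist_of_rowB`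
(`D.f = ((D.f)^{χ₋₃})^{χ₋₃}`, i.e. `a₃ₖ(D.f) = 0`, on the row `135b`); and the domain is inhabited under the items' binder `exists_isNewformOf`
(`N(135a1) = 135` by a kernel Tate certificate: type `IV` at `3`, `f₃ = 3`; `I₂` non-split at `5`).
HONEST FRAMING: unconditional (standard axioms); ONE level of C3 — nothing here proves C3 for all `N`, Manin's conjecture or BSD; item 22968 stays
OPEN as filed.
[cite: Manin1972, Prop. 1.4] [cite: Sturm1987, Thm. 1] [cite: AgasheRibetStein2006, §§1–2] [cite: CremonaAlgorithms1997, §2.10, Table 1 (135a1, 135b1), Table 3 (N = 135)]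
[cite: Shimura1971, Prop. 3.64] [cite: Stevens1989, Lemma (5.4) p. 97] [cite: Pal2012, Lemma 3.1] [cite: SilvermanAEC2009, VII.1 Remark 1.1]
-/

set_option autoImplicit false
-- lint-debt: the directory name repeats the summit name (sibling precedent `ManinLocalTwoThreeManinConstantEightyEight.lean`)
set_option linter.dupNamespace false

noncomputable section

open Complex
open UpperHalfPlane hiding I
open scoped MatrixGroups ModularForm
open ModularForm CongruenceSubgroup PowerSeries
open Literature.NumberTheory.ModularForms
open Literature.NumberTheory.EllipticCurves Literature.NumberTheory.EllipticCurves.ModularForms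

namespace Summit.BirchSwinnertonDyer.BirchSwinnertonDyer.Theorems.ManinLocalTwoThree.LevelOneThirtyFive

open Summit.BirchSwinnertonDyer.BirchSwinnertonDyer.Theorems.ManinLocalTwoThree.BracketSturm Summit.BirchSwinnertonDyer.BirchSwinnertonDyer.Theorems.ManinLocalTwoThree.PinningKernel Summit.BirchSwinnertonDyer.BirchSwinnertonDyer.Theorems.ManinLocalTwoThree.PinningOneThirtyFive
open Literature.NumberTheory.EllipticCurves.Rank1Residual.X11RankOneCertificates (discOf c4Of c6Of)
open Summit.BirchSwinnertonDyer.Rank1Residual.ManinAdditive (neronLattice_mem_iff_of_twist_pStar)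
open WeierstrassCurve (VariableChange)
open Summit.BirchSwinnertonDyer.Rank1Residual.Additive Literature.NumberTheory.Automorphic

set_option maxHeartbeats 4000000
set_option maxRecDepth 16384

/-! ## §1 The class `135b`: optimal curve `135b1 = [0, 0, 1, -27, -115]`, its pinning row and newform table -/

/-- `Δ, c₄, c₆` of `135b1`: `-4428675, 1296, 99144`. [cite: CremonaAlgorithms1997, Table 1 (135b1)] -/
theorem invariants_oneThirtyFiveB1 : discOf [0, 0, 1, -27, -115] = -4428675 ∧ c4Of [0, 0, 1, -27, -115] = 1296 ∧ c6Of [0, 0, 1, -27, -115] = 99144 := by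
  refine ⟨?_, ?_, ?_⟩ <;> decide

/-- `135b1` (integer-cast model) is globally minimal (`|Δ| = 3^11*5^2`: no `q¹² ∣ Δ`). [cite: SilvermanAEC2009, VII.1 Remark 1.1] -/
theorem isGloballyMinimal_oneThirtyFiveB1_cast :
    (⟨((0 : ℤ) : ℚ), ((0 : ℤ) : ℚ), ((1 : ℤ) : ℚ), ((-27 : ℤ) : ℚ), ((-115 : ℤ) : ℚ)⟩ : WeierstrassCurve ℚ).IsGloballyMinimal := by
  obtain ⟨hD, -, -⟩ := invariants_oneThirtyFiveB1
  refine WeierstrassCurve.isGloballyMinimal_of_int_kraus 0 0 1 (-27) (-115) fun q hq ↦ Or.inl fun h ↦ ?_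
  obtain ⟨h12, -⟩ := h
  rw [hD] at h12
  have hq1 : (q : ℤ) ∣ 4428675 := dvd_neg.mp (dvd_trans (dvd_pow_self _ (by norm_num)) h12)
  have hdvdN : q ∣ 3 ^ 11 * 5 ^ 2 := by
    have e : ((3 ^ 11 * 5 ^ 2 : ℕ) : ℤ) = 4428675 := by norm_num
    exact Int.natCast_dvd_natCast.mp (e ▸ hq1)
  have hpi := Nat.Prime.prime hq
  rcases hpi.dvd_or_dvd hdvdN with h | h
  · have := (Nat.prime_dvd_prime_iff_eq hq (by norm_num : Nat.Prime 3)).mp (hpi.dvd_of_dvd_pow h)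
    subst this; revert h12; norm_num
  · have := (Nat.prime_dvd_prime_iff_eq hq (by norm_num : Nat.Prime 5)).mp (hpi.dvd_of_dvd_pow h)
    subst this; revert h12; norm_num

/-- `135b1` is globally minimal. [cite: SilvermanAEC2009, VII.1 Remark 1.1] -/
theorem isGloballyMinimal_oneThirtyFiveB1 : (⟨0, 0, 1, -27, -115⟩ : WeierstrassCurve ℚ).IsGloballyMinimal := by
  rw [show (⟨0, 0, 1, -27, -115⟩ : WeierstrassCurve ℚ) = ⟨((0 : ℤ) : ℚ), ((0 : ℤ) : ℚ), ((1 : ℤ) : ℚ), ((-27 : ℤ) : ℚ), ((-115 : ℤ) : ℚ)⟩ by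
    ext <;> norm_num]
  exact isGloballyMinimal_oneThirtyFiveB1_cast

/-- `135b1` is an elliptic curve (`Δ = -4428675 ≠ 0`). [folklore] -/
theorem isElliptic_oneThirtyFiveB1 : (⟨0, 0, 1, -27, -115⟩ : WeierstrassCurve ℚ).IsElliptic :=
  ⟨by norm_num [WeierstrassCurve.Δ, WeierstrassCurve.b₂, WeierstrassCurve.b₄, WeierstrassCurve.b₆, WeierstrassCurve.b₈]⟩


/-- The pinning row of `135b`: `(p, a_p)` signature, denominator `120`, coordinates. [folklore] -/
def rowB : List (ℕ × ℤ) × ℤ × List ℤ :=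
  ([(3, 0), (2, 2), (5, 1), (7, -3), (11, 2), (13, -5), (17, 8), (19, 1), (23, -6), (29, -2), (31, 0)], 120, [0, 0, -5, -75, 45, 405, 40, 600, -105, -315, 81, 405, 9, 405, -40, -360, -40, -3240, 0, 0, 0, 0, -480, 300])

/-- The newform table `cFB = (aₙ(135b1))_{n < 218}`. [cite: CremonaAlgorithms1997, Table 3 (N = 135)] -/
def cFB : List ℤ :=
  [0, 1, 2, 0, 2, 1, 0, -3, 0, 0, 2, 2, 0, -5, -6, 0, -4, 8, 0, 1, 2, 0, 4, -6, 0, 1, -10, 0, -6, -2, 0, 0, -8, 0, 16, -3, 0, 5, 2, 0, 0, 10, 0, 4, 4, 0, -12, -4, 0, 2, 2, 0, -10, 2, 0, 2, 0, 0,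
   -4, 8, 0, 7, 0, 0, -8, -5, 0, -9, 16, 0, -6, -2, 0, -5, 10, 0, 2, -6, 0, -3, -4, 0, 20, -6, 0, 8, 8, 0, 0, 12, 0, 15, -12, 0, -8, 1, 0, -13, 4, 0, 2, 0, 0, 17, 0, 0, 4, -6, 0, -10, 4, 0, 12,
   -10, 0, -6, -4, 0, 16, -24, 0, -7, 14, 0, 0, 1, 0, -8, 0, 0, -10, -12, 0, -3, -18, 0, 0, 6, 0, -13, -6, 0, -4, -10, 0, -2, -10, 0, 10, 4, 0, 1, 0, 0, -12, 0, 0, 2, -6, 0, -8, 18, 0, -19, 20,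
   0, -12, 12, 0, 12, 16, 0, 8, 12, 0, -3, -8, 0, 24, -22, 0, 5, 30, 0, 0, 5, 0, 16, -8, 0, 2, 4, 0, 5, -26, 0, 4, 0, 0, -17, 0, 0, 0, 6, 0, 10, 34, 0, 20, 2, 0, 23, 4, 0, -12, 4, 0, 0]

/-- `goodCerts = [rowA, rowB]`. [folklore] -/
theorem goodCerts_eq_rows : goodCerts = [rowA, rowB] := rfl

/-- The pinning row `135b` read as a table identity: `120·cFB[n] = Σ_j y_j·tabsDeep_j[n]`, `n < 218`. [folklore] -/
theorem hF_rowB : ∀ n < 218, rowB.2.1 * cFB.getD n 0 = ∑ j : Fin 24, rowB.2.2.getD (j : ℕ) 0 * (tabsDeep j).getD n 0 := by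
  decide +kernel

/-- **The twist identity of the two newform tables**: `aₙ(135a) = (n/3)·aₙ(135b)` for `n < 218`. [cite: CremonaAlgorithms1997, Table 3 (N = 135)] -/
theorem cFA_eq_legendre_mul_cFB : ∀ n < 218, cFA.getD n 0 = legendreSym 3 n * cFB.getD n 0 := by
  decide +kernel

/-- **The first `218` coefficients of `D.f` on the row `135b` are `cFB`.** [cite: CremonaAlgorithms1997, Table 3 (N = 135)] -/
theorem cFB_eq_coeff_of_row {W : WeierstrassCurve ℚ} (D : ModularParametrizationData W 135)
    (C : Fin 24 → ModularForm (Gamma0 135) 2) (hC : ∀ i, ∀ τ : ℍ, C i τ = etaQuotient 135 (expFn (Ls[(i : ℕ)]).1) τ)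
    (hpin : ((rowB.2.1 : ℤ) : ℂ) • ModularFormClass.modularForm D.f = ∑ j : Fin 24, ((rowB.2.2.getD (j : ℕ) 0 : ℤ) : ℂ) • C j) :
    ∀ n < 218, ((cFB.getD n 0 : ℤ) : ℂ) = (qExpansion 1 ⇑D.f).coeff n := by
  intro n hn
  have h := congrArg (modCoefₗ 135 2 n) hpin
  rw [map_smul, smul_eq_mul, modCoefₗ_modularForm] at h
  have h2 : modCoefₗ 135 2 n (∑ j : Fin 24, ((rowB.2.2.getD (j : ℕ) 0 : ℤ) : ℂ) • C j) =
      ∑ j : Fin 24, ((rowB.2.2.getD (j : ℕ) 0 : ℤ) : ℂ) * (((tabsDeep j).getD n 0 : ℤ) : ℂ) := coeff_sum_smul_eq C hC rowB.2.2 n hn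
  have h3 : ((rowB.2.1 : ℤ) : ℂ) * ((cFB.getD n 0 : ℤ) : ℂ) =
      ∑ j : Fin 24, ((rowB.2.2.getD (j : ℕ) 0 : ℤ) : ℂ) * (((tabsDeep j).getD n 0 : ℤ) : ℂ) := by
    exact_mod_cast hF_rowB n hn
  rw [h2, ← h3] at h
  have hd : ((rowB.2.1 : ℤ) : ℂ) ≠ 0 := by norm_num [rowB]
  have h4 := mul_left_cancel₀ hd h
  unfold cuspCoeff at h4
  exact h4.symm

/-! ## §2 The aligned twist `135a1 ⊗ (−3) ≅ 135b1` -/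

/-- **The aligned twist model**: `(u,r,s,t) = (1,0,0,½)` carries the tree's quadratic twist `(135a1)^{(3*)}`, `3* = −3`, to `135b1`.
[cite: CremonaAlgorithms1997, Table 1 (135a1, 135b1)] [cite: SilvermanAEC2009, X.2 Prop. 2.4] -/
theorem twist_oneThirtyFiveA1 :
    (⟨1, 0, 0, 1/2⟩ : VariableChange ℚ) • (⟨0, 0, 1, -3, 4⟩ : WeierstrassCurve ℚ).quadraticTwist (((-1 : ℤ) ^ ((3 : ℕ) / 2) * ((3 : ℕ) : ℤ) : ℤ) : ℚ)
      = (⟨0, 0, 1, -27, -115⟩ : WeierstrassCurve ℚ) := by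
  have h32 : (((-1 : ℤ) ^ ((3 : ℕ) / 2) * ((3 : ℕ) : ℤ) : ℤ) : ℚ) = -3 := by norm_num
  rw [h32]
  ext <;> simp [WeierstrassCurve.quadraticTwist, WeierstrassCurve.b₂, WeierstrassCurve.b₄, WeierstrassCurve.b₆,
    WeierstrassCurve.variableChange_a₁, WeierstrassCurve.variableChange_a₂, WeierstrassCurve.variableChange_a₃,
    WeierstrassCurve.variableChange_a₄, WeierstrassCurve.variableChange_a₆] <;> norm_num

/-- **Alignment**: `Δ(135b1) = (3*)⁶·Δ(135a1)` (`u = 1`: both curves are `χ₋₃`-twist-minimal at their own fibre — the twist-minimal cell at `3`).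
[cite: CremonaAlgorithms1997, Table 1 (135a1, 135b1)] [cite: Pal2012, Lemma 3.1] -/
theorem delta_twist_oneThirtyFive : (⟨0, 0, 1, -27, -115⟩ : WeierstrassCurve ℚ).Δ
    = ((((-1 : ℤ) ^ ((3 : ℕ) / 2) * ((3 : ℕ) : ℤ) : ℤ)) : ℚ) ^ 6 * (⟨0, 0, 1, -3, 4⟩ : WeierstrassCurve ℚ).Δ := by
  norm_num [WeierstrassCurve.Δ, WeierstrassCurve.b₂, WeierstrassCurve.b₄, WeierstrassCurve.b₆, WeierstrassCurve.b₈]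

/-! ## §3 The transport on the row `135b` -/

/-- The Sturm bound at weight `2`: `⌊2·μ₀(135)/12⌋ = 36 < 218`. [cite: Sturm1987, Thm. 1] -/
theorem sturm_two_oneThirtyFive : (((2 : ℤ)) * gamma0Index 135).toNat / 12 < 218 := by
  rw [gamma0_data.1]; decide

/-- `a₃ₖ(135b) = 0` below `218` (additivity at `3`, read off the table). [cite: CremonaAlgorithms1997, Table 3 (N = 135)] -/
theorem cFB_eq_zero_of_three_dvd : ∀ n < 218, 3 ∣ n → cFB.getD n 0 = 0 := by
  decide +kernel

/-- **ROW `135b`: `a₃ₖ(D.f) = 0` for `3k < 218`**, hence (engine §2) `D.f = ((D.f)^{χ₋₃})^{χ₋₃}` in `S₂(Γ₀(135))` — the datum-internal root form.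
[cite: Sturm1987, Thm. 1] [cite: Shimura1971, Prop. 3.64] -/
theorem cuspCoeff_eq_zero_of_three_dvd_of_rowB {W : WeierstrassCurve ℚ} (D : ModularParametrizationData W 135)
    (C : Fin 24 → ModularForm (Gamma0 135) 2) (hC : ∀ i, ∀ τ : ℍ, C i τ = etaQuotient 135 (expFn (Ls[(i : ℕ)]).1) τ)
    (hpin : ((rowB.2.1 : ℤ) : ℂ) • ModularFormClass.modularForm D.f = ∑ j : Fin 24, ((rowB.2.2.getD (j : ℕ) 0 : ℤ) : ℂ) • C j) :
    ∀ n < 218, 3 ∣ n → cuspCoeff D.f n = 0 := by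
  intro n hn h3
  unfold cuspCoeff
  rw [← cFB_eq_coeff_of_row D C hC hpin n hn, cFB_eq_zero_of_three_dvd n hn h3, Int.cast_zero]

/-- **ROW `135b` IDENTIFIED AS A DOUBLE TWIST: `D.f = ((D.f)^{χ₋₃})^{χ₋₃}`** in `S₂(Γ₀(135))` for every `X₀(135)`-datum on the row `135b`.
[cite: Sturm1987, Thm. 1] [cite: Shimura1971, Prop. 3.64] -/
theorem f_eq_charTwist_charTwist_of_rowB {W : WeierstrassCurve ℚ} (D : ModularParametrizationData W 135)
    (C : Fin 24 → ModularForm (Gamma0 135) 2) (hC : ∀ i, ∀ τ : ℍ, C i τ = etaQuotient 135 (expFn (Ls[(i : ℕ)]).1) τ)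
    (hpin : ((rowB.2.1 : ℤ) : ℂ) • ModularFormClass.modularForm D.f = ∑ j : Fin 24, ((rowB.2.2.getD (j : ℕ) 0 : ℤ) : ℂ) • C j) :
    D.f = charTwist 135 (dvd_refl 135) (⟨15, rfl⟩ : 3 ^ 2 ∣ 135) (isQuadratic_quadraticChar_ringHomComp 3)
      (charTwist 135 (dvd_refl 135) (⟨15, rfl⟩ : 3 ^ 2 ∣ 135) (isQuadratic_quadraticChar_ringHomComp 3) D.f) :=
  SameLevelTwistRootForm.eq_charTwist_charTwist_of_cuspCoeff_eq_zero (q := 3) (by norm_num) _ D.f sturm_two_oneThirtyFive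
    (cuspCoeff_eq_zero_of_three_dvd_of_rowB D C hC hpin)

/-- **The root form's first `218` coefficients are `cFA`**: `aₙ((D.f)^{χ₋₃}) = (n/3)·aₙ(135b) = aₙ(135a)` on the row `135b`.
[cite: Shimura1971, Prop. 3.64] [cite: CremonaAlgorithms1997, Table 3 (N = 135)] -/
theorem cFA_eq_coeff_charTwist_of_rowB {W : WeierstrassCurve ℚ} (D : ModularParametrizationData W 135)
    (C : Fin 24 → ModularForm (Gamma0 135) 2) (hC : ∀ i, ∀ τ : ℍ, C i τ = etaQuotient 135 (expFn (Ls[(i : ℕ)]).1) τ)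
    (hpin : ((rowB.2.1 : ℤ) : ℂ) • ModularFormClass.modularForm D.f = ∑ j : Fin 24, ((rowB.2.2.getD (j : ℕ) 0 : ℤ) : ℂ) • C j) :
    ∀ n < 218, ((cFA.getD n 0 : ℤ) : ℂ) = (qExpansion 1
      ⇑(charTwist 135 (dvd_refl 135) (⟨15, rfl⟩ : 3 ^ 2 ∣ 135) (isQuadratic_quadraticChar_ringHomComp 3) D.f)).coeff n := by
  intro n hn
  change _ = cuspCoeff _ n
  rw [cuspCoeff_charTwist 135 _ _ (isQuadratic_quadraticChar_ringHomComp 3) (isPrimitive_quadraticChar_ringHomComp 3 (by norm_num)),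
    quadraticChar_ringHomComp_apply_natCast]
  unfold cuspCoeff
  rw [← cFB_eq_coeff_of_row D C hC hpin n hn]
  exact_mod_cast cFA_eq_legendre_mul_cFB n hn

/-- **`|c(D)| = 1` on the row `135b` BY THE SAME-LEVEL ALIGNED `χ₋₃`-TRANSPORT** (engine `…SameLevelTwistRootFormTransport` §3): root form
`(D.f)^{χ₋₃}` (first `218` coefficients `cFA`) ↦ class-`a` squeeze `Λ((D.f)^{χ₋₃}) ⊆ Λ_Néron(135a1)` ↦ aligned twist `135a1 ⊗ (−3) ≅ 135b1`
(`Λ(135b1) = g(χ₃)⁻¹·Λ(135a1)`, Pal `r = 1`) ↦ `Γ₀`-twisting ↦ Néron squeeze.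
[cite: Manin1972, Prop. 1.4] [cite: Stevens1989, Lemma (5.4) p. 97] [cite: Pal2012, Lemma 3.1] [cite: AgasheRibetStein2006, §§1–2]
[cite: CremonaAlgorithms1997, Table 1 (135a1, 135b1)] -/
theorem abs_maninConstant_eq_one_oneThirtyFiveB_of_row (W : WeierstrassCurve ℚ) [W.IsElliptic] [W.IsGloballyMinimal]
    (D : ModularParametrizationData W 135) (hopt : ∀ z ∈ D.L.lattice, ∃ w ∈ periodLattice D.f, z = D.c * w)
    (C : Fin 24 → ModularForm (Gamma0 135) 2) (hC : ∀ i, ∀ τ : ℍ, C i τ = etaQuotient 135 (expFn (Ls[(i : ℕ)]).1) τ)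
    (hpin : ((rowB.2.1 : ℤ) : ℂ) • ModularFormClass.modularForm D.f = ∑ j : Fin 24, ((rowB.2.2.getD (j : ℕ) 0 : ℤ) : ℂ) • C j) :
    |D.maninConstant| = 1 := by
  haveI := isElliptic_oneThirtyFiveA1
  haveI := isElliptic_oneThirtyFiveB1
  haveI := isGloballyMinimal_oneThirtyFiveB1
  obtain ⟨LA, hA2, hA3⟩ := ((⟨0, 0, 1, -3, 4⟩ : WeierstrassCurve ℚ).baseChange ℂ).exists_periodPair_of_isElliptic'
  have hLA : IsNeronLatticeOf ((⟨0, 0, 1, -3, 4⟩ : WeierstrassCurve ℚ).baseChange ℂ) LA := ⟨hA2, hA3⟩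
  exact SameLevelTwistRootForm.abs_maninConstant_eq_one_of_alignedTwist_of_squeeze (q := 3) (by norm_num) (⟨15, rfl⟩ : 3 ^ 2 ∣ 135)
    (⟨0, 0, 1, -3, 4⟩ : WeierstrassCurve ℚ) LA hLA (⟨0, 0, 1, -27, -115⟩ : WeierstrassCurve ℚ) _ twist_oneThirtyFiveA1
    delta_twist_oneThirtyFive W D sturm_two_oneThirtyFive (cuspCoeff_eq_zero_of_three_dvd_of_rowB D C hC hpin)
    (periodLatticeLe_oneThirtyFiveA_of_coeff C hC _ (cFA_eq_coeff_charTwist_of_rowB D C hC hpin) hLA) hopt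

/-! ## §4 The headline: `|c| = 1` on all of `X₀(135)` -/

/-- **`|c| = 1` FOR EVERY LATTICE-OPTIMAL `X₀(135)`-DATUM of every globally minimal elliptic curve over `ℚ`** — UNCONDITIONAL: an's two rows
(`135a` ↦ the Bracket–Sturm squeeze; `135b` ↦ the same-level aligned `χ₋₃`-transport). [cite: Manin1972, Prop. 1.4] [cite: AgasheRibetStein2006, §§1–2]
[cite: CremonaAlgorithms1997, Table 1 (135a1, 135b1)] -/
theorem abs_maninConstant_eq_one_oneThirtyFive (W : WeierstrassCurve ℚ) [W.IsElliptic] [W.IsGloballyMinimal]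
    (D : ModularParametrizationData W 135) (hopt : ∀ z ∈ D.L.lattice, ∃ w ∈ periodLattice D.f, z = D.c * w) :
    |D.maninConstant| = 1 := by
  obtain ⟨C, hC, c, hc, -, hpin⟩ := pinning D
  rw [goodCerts_eq_rows] at hc
  simp only [List.mem_cons, List.mem_nil_iff, or_false] at hc
  rcases hc with rfl | rfl
  · exact abs_maninConstant_eq_one_oneThirtyFiveA_of_row W D hopt C hC hpin
  · exact abs_maninConstant_eq_one_oneThirtyFiveB_of_row W D hopt C hC hpin

/-- **C3 `ManinPrimeToThreeAtNine` at `N = 135` (`3² ∣ 135`): `3 ∤ c(D)`** for every lattice-optimal `X₀(135)`-datum — UNCONDITIONAL.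
[cite: AgasheRibetStein2006, §§1–2] -/
theorem not_three_dvd_maninConstant_oneThirtyFive (W : WeierstrassCurve ℚ) [W.IsElliptic] [W.IsGloballyMinimal]
    (D : ModularParametrizationData W 135) (hopt : ∀ z ∈ D.L.lattice, ∃ w ∈ periodLattice D.f, z = D.c * w) :
    ¬ (3 : ℤ) ∣ D.maninConstant := by
  have h := abs_maninConstant_eq_one_oneThirtyFive W D hopt
  intro h3
  have := Int.le_of_dvd (by rw [h]; norm_num) ((dvd_abs _ _).mpr h3)
  rw [h] at this
  norm_num at this

/-- **No prime divides `c` on `X₀(135)`.** [cite: AgasheRibetStein2006, §§1–2] -/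
theorem not_prime_dvd_maninConstant_oneThirtyFive (W : WeierstrassCurve ℚ) [W.IsElliptic] [W.IsGloballyMinimal]
    (D : ModularParametrizationData W 135) (hopt : ∀ z ∈ D.L.lattice, ∃ w ∈ periodLattice D.f, z = D.c * w)
    {p : ℕ} (hp : p.Prime) : ¬ (p : ℤ) ∣ D.maninConstant := by
  have h := abs_maninConstant_eq_one_oneThirtyFive W D hopt
  intro hpd
  have h1 := Int.le_of_dvd (by rw [h]; norm_num) ((dvd_abs _ _).mpr hpd)
  rw [h] at h1
  have := hp.two_le
  omega

/-- **The C3 conclusion on the whole `X₀(135)`-domain**: `3² ∣ 135`, and `|c| = 1 ∧ 3 ∤ c` for every lattice-optimal `X₀(135)`-datum of every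
globally minimal elliptic curve over `ℚ` — UNCONDITIONAL; BSD and C3 for general `N` are NOT proved by this. [folklore] -/
theorem maninPrimeToThreeAtNine_oneThirtyFive :
    3 ^ 2 ∣ 135 ∧ ∀ (W : WeierstrassCurve ℚ) [W.IsElliptic] [W.IsGloballyMinimal] (D : ModularParametrizationData W 135),
      (∀ z ∈ D.L.lattice, ∃ w ∈ periodLattice D.f, z = D.c * w) → |D.maninConstant| = 1 ∧ ¬ (3 : ℤ) ∣ D.maninConstant :=
  ⟨⟨15, by norm_num⟩, fun W _ _ D hopt ↦ ⟨abs_maninConstant_eq_one_oneThirtyFive W D hopt, not_three_dvd_maninConstant_oneThirtyFive W D hopt⟩⟩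

/-! ## §5 The domain is inhabited under the items' binder `exists_isNewformOf` -/

/-- **`N(135a1) = 135 = 3³·5`**: Step-5 Tate certificate at `3` (`(r, s, t) = (1, 0, 1)` to `[0, 3, 3, 0, 0]`, `9 ∣ a₆`, `27 ∣ b₈`, `3² ∥ b₆`:
type `IV`, `f₃ = v₃(Δ) + 1 − 3 = 3`), non-split multiplicative at `5` (`f₅ = 1`), good at `2`; kernel-checked, minimality included.
[cite: Silverman1994, IV.9.4] [cite: CremonaAlgorithms1997, Table 1 (135a1)] -/
theorem conductorNorm_oneThirtyFiveA1 : (⟨0, 0, 1, -3, 4⟩ : WeierstrassCurve ℚ).conductorNorm ℤ = 135 := by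
  rw [show (⟨0, 0, 1, -3, 4⟩ : WeierstrassCurve ℚ) = ⟨((0 : ℤ) : ℚ), ((0 : ℤ) : ℚ), ((1 : ℤ) : ℚ), ((-3 : ℤ) : ℚ), ((4 : ℤ) : ℚ)⟩ by
    ext <;> norm_num]
  exact IntModelCond.conductorNorm_mk_eq_of_certs_of_eq 0 0 1 (-3) 4
    (cm := ⟨0, 4, 3, [⟨3, 1, 5, 2, 0⟩, ⟨5, 2, 2, 0, 0⟩]⟩) (c := ⟨0, 4, 3, 5, 2, 3, [⟨5, 2, 2, 0, 0⟩]⟩)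
    (l₂ := ⟨0, 0, 0, 0, 0, 0, 0⟩) (l₃ := ⟨2, 1, 0, 1, 5, 4, 2⟩)
    (by decide +kernel) (by decide +kernel) (by decide +kernel) (by decide +kernel) (by decide +kernel)

/-- **Modularity at `135a1`, levelled**: under `exists_isNewformOf`, `[0, 0, 1, −3, 4]` has a newform in `S₂(Γ₀(135))`.  CONDITIONAL on the
items' own binder. [cite: DiamondShurman2005, Thm. 8.8.3] -/
theorem exists_isNewformOf_oneThirtyFiveA1 (hnf : exists_isNewformOf) :
    ∃ f : CuspForm (Gamma0 135) 2, IsNewformOf (⟨0, 0, 1, -3, 4⟩ : WeierstrassCurve ℚ) f := by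
  haveI := isElliptic_oneThirtyFiveA1
  have key : ∀ (N : ℕ) [NeZero N], (⟨0, 0, 1, -3, 4⟩ : WeierstrassCurve ℚ).conductorNorm ℤ = N →
      ∃ f : CuspForm (Gamma0 N) 2, IsNewformOf (⟨0, 0, 1, -3, 4⟩ : WeierstrassCurve ℚ) f := by
    intro N _ hN
    subst hN
    exact hnf _
  haveI : NeZero (135 : ℕ) := ⟨by decide⟩
  exact key 135 conductorNorm_oneThirtyFiveA1

/-- **A lattice-optimal `X₀(135)`-datum on a globally minimal model in the class `135a` exists under modularity**, with `|c| = 1` and `3 ∤ c`;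
CONDITIONAL on `exists_isNewformOf` only (`N(135a1) = 135` by kernel Tate certificate, es's unconditional EXO). [cite: EdixhovenManin1991, Prop. 2] -/
theorem domain_inhabited_oneThirtyFive_of_modularity (hnf : exists_isNewformOf) :
    ∃ (W₀ : WeierstrassCurve ℚ) (_ : W₀.IsElliptic) (_ : W₀.IsGloballyMinimal) (D₀ : ModularParametrizationData W₀ 135),
      (⟨0, 0, 1, -3, 4⟩ : WeierstrassCurve ℚ).IsIsogenous W₀ ∧ (∀ z ∈ D₀.L.lattice, ∃ w ∈ periodLattice D₀.f, z = D₀.c * w) ∧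
      |D₀.maninConstant| = 1 ∧ ¬ (3 : ℤ) ∣ D₀.maninConstant := by
  haveI := isElliptic_oneThirtyFiveA1
  haveI : NeZero (135 : ℕ) := ⟨by decide⟩
  obtain ⟨f, hf⟩ := exists_isNewformOf_oneThirtyFiveA1 hnf
  obtain ⟨D⟩ := nonempty_modularParametrizationData_of_isNewformOf hf
  obtain ⟨W₀, h₀, hmin, D₀, -, hiso, hopt, -⟩ :=
    ExistsMinimalOptimalDatum.existsMinimalOptimalDatum_full (⟨0, 0, 1, -3, 4⟩ : WeierstrassCurve ℚ) D
  exact ⟨W₀, h₀, hmin, D₀, hiso, hopt, @abs_maninConstant_eq_one_oneThirtyFive W₀ h₀ hmin D₀ hopt,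
    @not_three_dvd_maninConstant_oneThirtyFive W₀ h₀ hmin D₀ hopt⟩


end Summit.BirchSwinnertonDyer.BirchSwinnertonDyer.Theorems.ManinLocalTwoThree.LevelOneThirtyFive

end
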